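import Literature.NumberTheory.Transcendental.ThetaSubgroupClassification
import Literature.NumberTheory.Transcendental.PkappaHardData
import Literature.NumberTheory.Transcendental.ChudnovskyAnalytic
import Literature.NumberTheory.Transcendental.TubbsPeriodsIndependence
import HarnessLib

/-!
# Tubbs 1990, Theorem 4 (periods form) — the zero estimate on `𝔾ₐ × 𝔾ₘ × E` (Cor. 5.2)

Topic `Literature/NumberTheory/Transcendental` (trunk T-TRANSCEND). Second layer of the proof of the
named fact `Literature.NumberTheory.Transcendental.Tubbs1990_thm4_periods`
(`TubbsPeriodsIndependence.lean`; R. Tubbs, *Algebraic groups and small transcendence degree, II*,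
J. Number Theory 35 (1990), Thm 4 p. 112, Remark p. 114 = Chudnovsky 1984, Ch. 7, Thm 4.1 (i)):
`trdeg_ℚ ℚ(g₂, g₃, ω₁, ω₂, c, e^{cω₁}, e^{cω₂}) ≥ 2`.

Tubbs's proof (§5, pp. 124–127) is Gel'fond's method on `G = 𝔾ₐ × 𝔾ₘ × E` with the one-parameter
subgroup `φ(z) = (z, e^{cz}, (σ³ : σ³℘ : σ³℘′)(z))` and the points `z ∈ ω₁/2 + ℤω₁ + ℤω₂`; its
Corollary 5.2 (p. 125: "by Théorème 2.1 of [Philippon 1986] … there exists `y₀ ∈ Y(c₃₄S)`,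
`t₀ ≤ T` with `F^{(t₀)}(y₀) ≠ 0`") is the NON-VANISHING step: an auxiliary function
`F(z) = ∑ p_{ijk} zⁱ e^{jcz} ℘(z)ᵏ` (`i, k ≤ D`, `j ≤ L₁`) with too many zeros of too high an
order at these points is identically zero. Tubbs invokes Philippon's zero estimate with the
TRIDEGREES `(D, L₁, D)` (count `≍ D²L₁`). This file PROVES the corollary from the tree's
single-graded Philippon–Roy zero estimate `AnalyticGroupModel.zero_estimate` (`ZeroEstMain.lean`)
on the theta model `GaGmE.Std.thetaModel₀ L 0` of `M₀ = 𝔾ₘ × E × 𝔾ₐ ⊂ ℙ¹¹` (`PkappaHardData.lean`,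
`β = γ = δ = Unit`, `κ = 0`; obstruction subgroups classified by
`GaGmE.Std.classification_oneFactor_of_hardData`, `ThetaSubgroupClassification.lean`), by the
classical isogeny trick which recovers the multidegree count from the single-degree one:

* pull the form back along `[m] : 𝔾ₘ → 𝔾ₘ` (`v ↦ vᵐ`), so that the `𝔾ₘ`-degree `L₁` becomes
  `mL₁ ≤ D` and the form is a single Segre form of degree `D` (`segreMon`, `auxPoly`); the
  one-parameter subgroup becomes `ξ ↦ (e^{cξ/m}, ξ, ξ)` and the pulled-back form is invariant under
  the `m`-torsion `μ_m ⊂ 𝔾ₘ`, so it vanishes at the `m`-fold enlarged point set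
  `σ_{n,k} = (c yₙ/m + 2πik/m, yₙ, yₙ)`, `yₙ = n₁ω₁ + n₂ω₂`, `k mod m` (`pts`);
* Philippon's single-degree count `c·D³` against `card Σ = m X²` reads
  `T·mX² > c D³ ≥ c·m·D²L₁`, i.e. `T X² > c D² L₁` — the trigraded inequality; the seven proper
  obstruction subgroups `{0}, 𝔾ₐ, 𝔾ₘ, E, 𝔾ₐ𝔾ₘ, 𝔾ₐE, 𝔾ₘE` reduce likewise (`cosets_*`), the count
  `card((Σ + 𝔾ₐ)/𝔾ₐ) ≥ mX` using `‖e^{cω₂}‖ ≠ 1` (Tubbs p. 126, tree: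
  `Tubbs1990_thm4_periods_of_norm_exp_ne_one`);
* the base point `ω₁/2` is moved into the form by Roy's translation operator
  (`AnalyticGroupModel.translForm`, degree `4D`), which costs only constants.

Main result: `Tubbs.exists_iteratedDeriv_auxF_ne_zero` — under four numeric inequalities between
`T', X, m, D` and the model constant `c_Z(L) = mainConst`, a non-zero coefficient family `p` has
some `F^{(k)}(ω₁/2 + n₁ω₁ + n₂ω₂) ≠ 0` with `n₁, n₂ < 3X`, `k ≤ 3T'` (here `F = Tubbs.auxF` is the
ENTIRE version `∑ p_{ijk} zⁱ e^{jcz} P₁(z)ᵏ P₀(z)^{D-k}`, `P₀ = σ³`, `P₁ = σ³℘`).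

Everything is PROVED; no named facts, no new definitions of mathematical content beyond the
explicit auxiliary objects (`segreMon`, `auxPoly`, `auxF`, `pt`, `pts`).

## References

* R. Tubbs, J. Number Theory 35 (1990), §4 (13)–(18) pp. 120–121, §5 Cor. 5.2 pp. 125–126. [Tubbs1990]
* P. Philippon, *Lemmes de zéros dans les groupes algébriques commutatifs*, Bull. SMF 114 (1986),
  Thm. 2.1. [Philippon1986]
* Yu. V. Nesterenko, P. Philippon (eds.), LNM 1752 (2001), Ch. 11 (D. Roy), Thm. 4.1. [NesterenkoPhilippon2001]
-/

noncomputable section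

open Complex MvPolynomial Set Module Filter Topology
open scoped PeriodPair Pointwise

namespace Literature.NumberTheory.Transcendental

namespace Tubbs

open GaGmE GaGmE.Std AnalyticGroupModel

/-! ### The group `M₀ = 𝔾ₘ × E × 𝔾ₐ`: the theta model with `β = γ = δ = Unit`, `κ = 0` -/

/-- `Lie M₀ = ℂ³` with coordinates `y` (`𝔾ₘ`), `z` (`E`), `s` (`𝔾ₐ`). [folklore] -/
abbrev V3 : Type := Unit ⊕ (Unit ⊕ Unit) → ℂ

/-- The `12` projective coordinates of `M₀ ⊂ ℙ¹ × ℙ² × ℙ¹ ⊂ ℙ¹¹`. [folklore] -/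
abbrev Idx : Type := Option Unit × ThetaIdx Unit Unit

/-- The push-out datum `κ = 0` (`P₀ = E × 𝔾ₐ`). [folklore] -/
def κ0 : Unit → Unit → Kbar := fun _ _ => 0

/-- `κ = 0`. [folklore] -/
@[simp] theorem κ0_apply (e b : Unit) : κ0 e b = 0 := rfl

/-- The theta model of `M₀ = 𝔾ₘ × E × 𝔾ₐ` (an instance of `GaGmE.Std.thetaModel₀`). [folklore] -/
abbrev model (L : PeriodPair) : AnalyticGroupModel V3 (nIdx Unit Unit Unit) := thetaModel₀ L κ0

/-- The block vector `(y, z, s) ∈ Lie M₀`. [folklore] -/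
def pt (y z s : ℂ) : V3 := coords (fun _ => y) (fun _ => z) (fun _ => s)

/-- `y`-coordinate of `pt`. [folklore] -/
@[simp] theorem pt_iy (y z s : ℂ) (j : Unit) : pt y z s (iy j) = y := rfl
/-- `z`-coordinate of `pt`. [folklore] -/
@[simp] theorem pt_iz (y z s : ℂ) (b : Unit) : pt y z s (iz b) = z := rfl
/-- `s`-coordinate of `pt`. [folklore] -/
@[simp] theorem pt_is (y z s : ℂ) (e : Unit) : pt y z s (is e) = s := rfl

/-- Every vector of `Lie M₀` is a `pt`. [folklore] -/
theorem pt_eta (w : V3) : pt (w (iy ())) (w (iz ())) (w (is ())) = w := by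
  funext x
  rcases x with ⟨⟨⟩⟩ | ⟨⟨⟩⟩ | ⟨⟨⟩⟩ <;> rfl

/-- `pt` is additive. [folklore] -/
theorem pt_add (y z s y' z' s' : ℂ) : pt y z s + pt y' z' s' = pt (y + y') (z + z') (s + s') := by
  funext x
  rcases x with ⟨⟨⟩⟩ | ⟨⟨⟩⟩ | ⟨⟨⟩⟩ <;> rfl

/-- `pt 0 0 0 = 0`. [folklore] -/
@[simp] theorem pt_zero : pt 0 0 0 = 0 := by
  funext x
  rcases x with ⟨⟨⟩⟩ | ⟨⟨⟩⟩ | ⟨⟨⟩⟩ <;> rfl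

/-- Scalar multiples of `pt`. [folklore] -/
theorem smul_pt (a y z s : ℂ) : a • pt y z s = pt (a * y) (a * z) (a * s) := by
  funext x
  rcases x with ⟨⟨⟩⟩ | ⟨⟨⟩⟩ | ⟨⟨⟩⟩ <;> rfl

/-- Negation of `pt`. [folklore] -/
theorem neg_pt (y z s : ℂ) : -pt y z s = pt (-y) (-z) (-s) := by
  funext x
  rcases x with ⟨⟨⟩⟩ | ⟨⟨⟩⟩ | ⟨⟨⟩⟩ <;> rfl

/-- `pt` is injective. [folklore] -/
theorem pt_inj {y z s y' z' s' : ℂ} (h : pt y z s = pt y' z' s') : y = y' ∧ z = z' ∧ s = s' :=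
  ⟨by simpa using congr_fun h (iy ()), by simpa using congr_fun h (iz ()), by simpa using congr_fun h (is ())⟩

/-- Finite sums of `pt`. [folklore] -/
theorem sum_pt {ι : Type*} (u : Finset ι) (y z s : ι → ℂ) :
    ∑ i ∈ u, pt (y i) (z i) (s i) = pt (∑ i ∈ u, y i) (∑ i ∈ u, z i) (∑ i ∈ u, s i) := by
  classical
  induction u using Finset.induction_on with
  | empty => simp
  | insert a u ha ih => rw [Finset.sum_insert ha, ih, pt_add, Finset.sum_insert ha, Finset.sum_insert ha,
      Finset.sum_insert ha]

/-! ### The theta functions of `M₀` -/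

/-- `Θ_{(a,(M,none))}(w) = T_a(w) · P_{M}(z)`. [folklore] -/
theorem theta_none (L : PeriodPair) (a : Option Unit) (M : Unit → Fin 3) (w : V3) :
    theta L κ0 (a, (M, none)) w = thetaT a w * L.univExtP (M ()) (w (iz ())) := by
  simp [theta, thetaPnone]

/-- `Θ_{(a,(M,some e))}(w) = T_a(w) · s · P_{M}(z)` (`κ = 0`). [folklore] -/
theorem theta_some (L : PeriodPair) (a : Option Unit) (M : Unit → Fin 3) (e : Unit) (w : V3) :
    theta L κ0 (a, (M, some e)) w = thetaT a w * (w (is ()) * L.univExtP (M ()) (w (iz ()))) := by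
  simp [theta, thetaPsome, thetaPnone]

/-! ### Segre monomials -/

/-- The Segre coordinate used at position `l` of the monomial `sⁱ vⁿ P₁ᵏ P₀^{D-k}`. [folklore] -/
def segreIdx (i n k l : ℕ) : Idx :=
  (if l < n then some () else none, (fun _ => if l < k then 1 else 0, if l < i then some () else none))

/-- **The Segre monomial** of degree `D` whose theta value is `(e^y)ⁿ sⁱ P₁(z)ᵏ P₀(z)^{D-k}`
(`i, n, k ≤ D`). [folklore] -/
def segreMon (D i n k : ℕ) : MvPolynomial Idx ℂ := ∏ l ∈ Finset.range D, X (segreIdx i n k l)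

/-- The Segre monomial is a form of degree `D`. [folklore] -/
theorem segreMon_isHomogeneous (D i n k : ℕ) : (segreMon D i n k).IsHomogeneous D := by
  have := IsHomogeneous.prod (Finset.range D) (fun l => (X (segreIdx i n k l) : MvPolynomial Idx ℂ))
    (fun _ => 1) fun l _ => isHomogeneous_X ℂ _
  simpa [segreMon] using this

/-- `∏_{l < D} (if l < n then a else b) = aⁿ b^{D-n}` for `n ≤ D`. [folklore] -/
theorem prod_range_ite_lt (a b : ℂ) : ∀ (D n : ℕ), n ≤ D →
    ∏ l ∈ Finset.range D, (if l < n then a else b) = a ^ n * b ^ (D - n)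
  | 0, n, hn => by
    obtain rfl : n = 0 := Nat.le_zero.mp hn
    simp
  | D + 1, n, hn => by
    rcases Nat.lt_or_eq_of_le hn with h | rfl
    · rw [Finset.prod_range_succ, prod_range_ite_lt a b D n (Nat.le_of_lt_succ h), if_neg (by omega),
        show D + 1 - n = (D - n) + 1 by omega, pow_succ]
      ring
    · rw [Finset.prod_congr rfl fun l hl => if_pos (Finset.mem_range.mp hl), Finset.prod_const,
        Finset.card_range, Nat.sub_self, pow_zero, mul_one]

/-- The theta value of a single Segre coordinate. [folklore] -/
theorem theta_segreIdx (L : PeriodPair) (i n k l : ℕ) (w : V3) :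
    theta L κ0 (segreIdx i n k l) w =
      (if l < n then cexp (w (iy ())) else 1) * ((if l < i then w (is ()) else 1) *
        (if l < k then L.univExtP 1 (w (iz ())) else L.univExtP 0 (w (iz ())))) := by
  unfold segreIdx
  by_cases hn : l < n <;> by_cases hi : l < i <;> by_cases hk : l < k <;>
    simp [hn, hi, hk, theta_none, theta_some]

/-- **Theta value of the Segre monomial**: `(e^y)ⁿ · sⁱ · P₁(z)ᵏ · P₀(z)^{D-k}`. [folklore] -/
theorem thetaEval_segreMon (L : PeriodPair) {D i n k : ℕ} (hi : i ≤ D) (hn : n ≤ D) (hk : k ≤ D) (w : V3) :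
    thetaEval L κ0 (segreMon D i n k) w =
      cexp (w (iy ())) ^ n * w (is ()) ^ i * (L.univExtP 1 (w (iz ())) ^ k * L.univExtP 0 (w (iz ())) ^ (D - k)) := by
  simp only [thetaEval, segreMon, map_prod, eval_X]
  change ∏ l ∈ Finset.range D, theta L κ0 (segreIdx i n k l) w = _
  simp only [theta_segreIdx, Finset.prod_mul_distrib]
  have hE : ∏ l ∈ Finset.range D, (if l < k then L.univExtP 1 (w (iz ())) else L.univExtP 0 (w (iz ()))) =
      L.univExtP 1 (w (iz ())) ^ k * L.univExtP 0 (w (iz ())) ^ (D - k) := prod_range_ite_lt _ _ D k hk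
  rw [prod_range_ite_lt _ _ D n hn, prod_range_ite_lt _ _ D i hi, hE, one_pow, one_pow, mul_one, mul_one]
  ring

/-! ### The auxiliary form and the auxiliary function -/

/-- Coefficient families `p_{ijk}`, `i ≤ D`, `j ≤ L₁`, `k ≤ D`. [folklore] -/
abbrev Coeff (D L₁ : ℕ) : Type := Fin (D + 1) × Fin (L₁ + 1) × Fin (D + 1)

/-- **The auxiliary form** `P̃ = ∑ p_{ijk} · (Segre monomial of sⁱ v^{mj} P₁ᵏ P₀^{D-k})`, a form
of degree `D` on `M₀` — the pull-back along `[m]` on `𝔾ₘ` of Tubbs's trihomogeneous auxiliary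
polynomial of tridegree `(D, L₁, D)`. [cite: Tubbs1990, §5 Prop. 5.1 (p. 125)] -/
def auxPoly (D L₁ m : ℕ) (p : Coeff D L₁ → ℂ) : MvPolynomial Idx ℂ :=
  ∑ ijk : Coeff D L₁, C (p ijk) * segreMon D ijk.1 (m * ijk.2.1) ijk.2.2

/-- The auxiliary form is homogeneous of degree `D`. [folklore] -/
theorem auxPoly_isHomogeneous (D L₁ m : ℕ) (p : Coeff D L₁ → ℂ) : (auxPoly D L₁ m p).IsHomogeneous D := by
  unfold auxPoly
  refine IsHomogeneous.sum _ _ _ fun ijk _ => ?_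
  simpa using (isHomogeneous_C Idx (p ijk)).mul (segreMon_isHomogeneous D ijk.1 (m * ijk.2.1) ijk.2.2)

/-- **The auxiliary function** (entire version)
`F_p(z) = ∑ p_{ijk} zⁱ e^{jcz} P₁(z)ᵏ P₀(z)^{D-k}` (`= σ(z)^{3D} ∑ p_{ijk} zⁱ e^{jcz} ℘(z)ᵏ` off the
lattice). [cite: Tubbs1990, §5 Prop. 5.1 (p. 125)] -/
def auxF (L : PeriodPair) (c : ℂ) (D L₁ : ℕ) (p : Coeff D L₁ → ℂ) (z : ℂ) : ℂ :=
  ∑ ijk : Coeff D L₁, p ijk *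
    (z ^ (ijk.1 : ℕ) * cexp ((ijk.2.1 : ℕ) * (c * z)) * (L.univExtP 1 z ^ (ijk.2.2 : ℕ) * L.univExtP 0 z ^ (D - ijk.2.2)))

/-- The auxiliary function is entire. [folklore] -/
theorem differentiable_auxF (L : PeriodPair) (c : ℂ) (D L₁ : ℕ) (p : Coeff D L₁ → ℂ) :
    Differentiable ℂ (auxF L c D L₁ p) := by
  unfold auxF
  refine Differentiable.fun_sum fun ijk _ => (differentiable_const _).mul ?_
  refine ((differentiable_pow _).mul ?_).mul
    (((L.differentiable_univExtP 1).pow _).mul ((L.differentiable_univExtP 0).pow _))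
  exact differentiable_exp.comp ((differentiable_const _).mul ((differentiable_const _).mul differentiable_id))

/-- **Theta value of the auxiliary form** at a general point `(y, z, s)`:
`∑ p_{ijk} (e^y)^{mj} sⁱ P₁(z)ᵏ P₀(z)^{D-k}`. [folklore] -/
theorem thetaEval_auxPoly (L : PeriodPair) {D L₁ m : ℕ} (hmL : m * L₁ ≤ D) (p : Coeff D L₁ → ℂ) (w : V3) :
    thetaEval L κ0 (auxPoly D L₁ m p) w = ∑ ijk : Coeff D L₁, p ijk *
      (cexp (w (iy ())) ^ (m * ijk.2.1) * w (is ()) ^ (ijk.1 : ℕ) *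
        (L.univExtP 1 (w (iz ())) ^ (ijk.2.2 : ℕ) * L.univExtP 0 (w (iz ())) ^ (D - ijk.2.2))) := by
  unfold auxPoly
  simp only [thetaEval, map_sum, map_mul, eval_C]
  refine Finset.sum_congr rfl fun ijk _ => ?_
  congr 1
  have hi : (ijk.1 : ℕ) ≤ D := Nat.le_of_lt_succ ijk.1.isLt
  have hk : (ijk.2.2 : ℕ) ≤ D := Nat.le_of_lt_succ ijk.2.2.isLt
  have hn : m * (ijk.2.1 : ℕ) ≤ D := (Nat.mul_le_mul_left m (Nat.le_of_lt_succ ijk.2.1.isLt)).trans hmL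
  exact thetaEval_segreMon L hi hn hk w

/-- **The pull-back identity**: at a point whose `𝔾ₘ`-coordinate `y` satisfies `e^{my} = e^{cz}` and
whose `𝔾ₐ`-coordinate equals its `E`-coordinate `z`, the theta value of the auxiliary form is the
auxiliary function at `z`. [folklore] -/
theorem thetaEval_auxPoly_eq_auxF (L : PeriodPair) (c : ℂ) {D L₁ m : ℕ} (hmL : m * L₁ ≤ D) (p : Coeff D L₁ → ℂ)
    (w : V3) (hy : cexp ((m : ℂ) * w (iy ())) = cexp (c * w (iz ()))) (hs : w (is ()) = w (iz ())) :
    thetaEval L κ0 (auxPoly D L₁ m p) w = auxF L c D L₁ p (w (iz ())) := by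
  rw [thetaEval_auxPoly L hmL, auxF]
  refine Finset.sum_congr rfl fun ijk _ => ?_
  rw [hs, pow_mul, ← Complex.exp_nat_mul, hy, ← Complex.exp_nat_mul]
  ring


/-! ### The points `σ_{n,k}`, the base point `ω₁/2` and the direction of the one-parameter subgroup -/

/-- The lattice point `y_n = n₁ω₁ + n₂ω₂`. [folklore] -/
def latt (L : PeriodPair) (n₁ n₂ : ℕ) : ℂ := n₁ * L.ω₁ + n₂ * L.ω₂

/-- `y_0 = 0`. [folklore] -/
@[simp] theorem latt_zero (L : PeriodPair) : latt L 0 0 = 0 := by simp [latt]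

/-- `y_n` is additive in `n`. [folklore] -/
theorem latt_add (L : PeriodPair) (n₁ n₂ n₁' n₂' : ℕ) :
    latt L (n₁ + n₁') (n₂ + n₂') = latt L n₁ n₂ + latt L n₁' n₂' := by
  simp only [latt, Nat.cast_add]; ring

/-- `y_n ∈ Λ`. [folklore] -/
theorem latt_mem_lattice (L : PeriodPair) (n₁ n₂ : ℕ) : latt L n₁ n₂ ∈ L.lattice := by
  unfold latt
  exact L.lattice.add_mem (by simpa using L.lattice.smul_mem (n₁ : ℤ) L.ω₁_mem_lattice)
    (by simpa using L.lattice.smul_mem (n₂ : ℤ) L.ω₂_mem_lattice)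

/-- `n ↦ y_n` is injective (the basis periods are `ℝ`-linearly independent). [folklore] -/
theorem latt_injective (L : PeriodPair) {n₁ n₂ n₁' n₂' : ℕ} (h : latt L n₁ n₂ = latt L n₁' n₂') :
    n₁ = n₁' ∧ n₂ = n₂' := by
  unfold latt at h
  have h' : ((n₁ : ℝ) - n₁') • L.ω₁ + ((n₂ : ℝ) - n₂') • L.ω₂ = 0 := by
    simp only [Complex.real_smul, Complex.ofReal_sub, Complex.ofReal_natCast]
    linear_combination h
  have := LinearIndependent.pair_iff.mp L.indep _ _ h'
  constructor
  · exact_mod_cast sub_eq_zero.mp this.1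
  · exact_mod_cast sub_eq_zero.mp this.2

/-- The general point `(c·Y/m + 2πiK/m, Y, Y)` of `Lie M₀` lying over `φ̃(Y) + (μ_m-torsion)`. [folklore] -/
def gpt (c : ℂ) (m : ℕ) (Y : ℂ) (K : ℕ) : V3 :=
  pt (c * Y / m + 2 * Real.pi * I * K / m) Y Y

/-- `gpt` is additive. [folklore] -/
theorem gpt_add (c : ℂ) (m : ℕ) (Y Y' : ℂ) (K K' : ℕ) :
    gpt c m Y K + gpt c m Y' K' = gpt c m (Y + Y') (K + K') := by
  rw [gpt, gpt, gpt, pt_add]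
  congr 1
  push_cast; ring

/-- `gpt c m 0 0 = 0`. [folklore] -/
@[simp] theorem gpt_zero (c : ℂ) (m : ℕ) : gpt c m 0 0 = 0 := by
  simp [gpt]

/-- **The points `σ_{n,k}`** (`n₁, n₂ < X`, `k < m`): the logarithms
`(c yₙ/m + 2πik/m, yₙ, yₙ)` of the points `φ̃(yₙ) + (ζ_mᵏ, 0, 0)` of `M₀`. [cite: Tubbs1990, §5 (Y(S), p. 124)] -/
def pts (L : PeriodPair) (c : ℂ) (m X : ℕ) : Set V3 :=
  Set.range fun q : Fin X × Fin X × Fin m => gpt c m (latt L q.1 q.2.1) q.2.2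

/-- The point set is finite. [folklore] -/
theorem pts_finite (L : PeriodPair) (c : ℂ) (m X : ℕ) : (pts L c m X).Finite := Set.finite_range _

/-- `0 ∈ Σ`. [folklore] -/
theorem zero_mem_pts (L : PeriodPair) (c : ℂ) {m X : ℕ} (hm : 1 ≤ m) (hX : 1 ≤ X) : (0 : V3) ∈ pts L c m X :=
  ⟨(⟨0, hX⟩, ⟨0, hX⟩, ⟨0, hm⟩), by simp⟩

/-- **`Σ(k)` consists of points `(c Y/m + 2πiK/m, Y, Y)` with `Y = y_n`, `n₁, n₂ ≤ k(X-1)`.** [folklore] -/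
theorem mem_sumset_pts (L : PeriodPair) (c : ℂ) {m X k : ℕ} {v : V3} (hv : v ∈ sumset (pts L c m X) k) :
    ∃ n₁ n₂ K : ℕ, n₁ ≤ k * (X - 1) ∧ n₂ ≤ k * (X - 1) ∧ v = gpt c m (latt L n₁ n₂) K := by
  obtain ⟨f, hf, rfl⟩ := hv
  choose q hq using hf
  refine ⟨∑ i, (q i).1, ∑ i, (q i).2.1, ∑ i, (q i).2.2, ?_, ?_, ?_⟩
  · calc ∑ i, ((q i).1 : ℕ) ≤ ∑ _i : Fin k, (X - 1) := Finset.sum_le_sum fun i _ => Nat.le_sub_one_of_lt (q i).1.isLt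
      _ = k * (X - 1) := by simp
  · calc ∑ i, ((q i).2.1 : ℕ) ≤ ∑ _i : Fin k, (X - 1) := Finset.sum_le_sum fun i _ => Nat.le_sub_one_of_lt (q i).2.1.isLt
      _ = k * (X - 1) := by simp
  · have : ∀ i, f i = gpt c m (latt L (q i).1 (q i).2.1) (q i).2.2 := fun i => (hq i).symm
    simp only [this, gpt, latt]
    rw [sum_pt]
    congr 1 <;> push_cast
    · rw [Finset.sum_add_distrib, ← Finset.sum_div, ← Finset.sum_div, ← Finset.mul_sum, ← Finset.mul_sum,
        Finset.sum_add_distrib, ← Finset.sum_mul, ← Finset.sum_mul]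
    · rw [Finset.sum_add_distrib, ← Finset.sum_mul, ← Finset.sum_mul]
    · rw [Finset.sum_add_distrib, ← Finset.sum_mul, ← Finset.sum_mul]

/-- **The base point** `(c ω₁/(2m), ω₁/2, ω₁/2)` (logarithm of `φ̃(ω₁/2)`). [folklore] -/
def bpt (L : PeriodPair) (c : ℂ) (m : ℕ) : V3 := pt (c * (L.ω₁ / 2) / m) (L.ω₁ / 2) (L.ω₁ / 2)

/-- **The direction** `x₀ = (c/m, 1, 1)` of the one-parameter subgroup `φ̃(ξ) = (e^{cξ/m}, ξ, ξ)`. [folklore] -/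
def dir (c : ℂ) (m : ℕ) : V3 := pt (c / m) 1 1

/-- The direction is non-zero. [folklore] -/
theorem dir_ne_zero (c : ℂ) (m : ℕ) : dir c m ≠ 0 := fun h => by
  have := congr_fun h (iz ())
  simp [dir] at this

/-- The points of the line through `σ + ω₁/2` in the direction `x₀`. [folklore] -/
theorem gpt_add_bpt_add_smul_dir (L : PeriodPair) (c : ℂ) (m : ℕ) (Y : ℂ) (K : ℕ) (t : ℂ) :
    gpt c m Y K + bpt L c m + t • dir c m =
      pt (c * (Y + L.ω₁ / 2 + t) / m + 2 * Real.pi * I * K / m) (Y + L.ω₁ / 2 + t) (Y + L.ω₁ / 2 + t) := by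
  rw [gpt, bpt, dir, smul_pt, pt_add, pt_add]
  congr 1 <;> ring

/-- `e^{m(cZ/m + 2πiK/m)} = e^{cZ}`. [folklore] -/
theorem cexp_mul_coord (c : ℂ) {m : ℕ} (hm : 1 ≤ m) (Z : ℂ) (K : ℕ) :
    cexp ((m : ℂ) * (c * Z / m + 2 * Real.pi * I * K / m)) = cexp (c * Z) := by
  have hm0 : (m : ℂ) ≠ 0 := by exact_mod_cast (show m ≠ 0 by omega)
  rw [show (m : ℂ) * (c * Z / m + 2 * Real.pi * I * K / m) = c * Z + K * (2 * Real.pi * I) by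
    rw [mul_add, mul_div_cancel₀ _ hm0, mul_div_cancel₀ _ hm0]; ring,
    Complex.exp_add, Complex.exp_nat_mul_two_pi_mul_I, mul_one]

/-! ### The form on the model: transport and translation to the base point -/

section Model

variable (L : PeriodPair) (c : ℂ) {D L₁ m : ℕ}

/-- The auxiliary form transported to the model's indexing `Fin (N + 1)`. [folklore] -/
def auxPolyF (D L₁ m : ℕ) (p : Coeff D L₁ → ℂ) : MvPolynomial (Fin (nIdx Unit Unit Unit + 1)) ℂ :=
  rename (idxEquiv Unit Unit Unit).symm (auxPoly D L₁ m p)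

/-- It is a form of degree `D`. [folklore] -/
theorem auxPolyF_isHomogeneous (D L₁ m : ℕ) (p : Coeff D L₁ → ℂ) : (auxPolyF D L₁ m p).IsHomogeneous D :=
  (auxPoly_isHomogeneous D L₁ m p).rename_isHomogeneous

/-- `F_{P̃}` is `thetaEval` of the auxiliary form. [folklore] -/
theorem F_auxPolyF (p : Coeff D L₁ → ℂ) (w : V3) :
    (model L).F (auxPolyF D L₁ m p) w = thetaEval L κ0 (auxPoly D L₁ m p) w :=
  F_thetaModel_rename L κ0 (hardData L κ0) _ w

/-- **The translated form** `P̃' = P̃ ∘ τ_{ω₁/2}` via the addition law `α` (a form of degree `4D`). [folklore] -/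
def auxPolyT (D L₁ m : ℕ) (α : Fin (model L).nLaw) (p : Coeff D L₁ → ℂ) :
    MvPolynomial (Fin (nIdx Unit Unit Unit + 1)) ℂ :=
  (model L).translForm α (bpt L c m) (auxPolyF D L₁ m p)

/-- The translated form is homogeneous of degree `4D`. [folklore] -/
theorem auxPolyT_isHomogeneous (D L₁ m : ℕ) (α : Fin (model L).nLaw) (p : Coeff D L₁ → ℂ) :
    (auxPolyT L c D L₁ m α p).IsHomogeneous (4 * D) :=
  (model L).isHomogeneous_translForm α _ (auxPolyF_isHomogeneous D L₁ m p)

/-- **`F_{P̃'}` on the lines through the points**: for `σ = (cY/m + 2πiK/m, Y, Y)`,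
`F_{P̃'}(σ + t x₀) = λ^α(σ + t x₀, b)^D · F_p(Y + ω₁/2 + t)`. [folklore] -/
theorem F_auxPolyT_line (hm : 1 ≤ m) (hmL : m * L₁ ≤ D) (α : Fin (model L).nLaw) (p : Coeff D L₁ → ℂ)
    (Y : ℂ) (K : ℕ) (t : ℂ) :
    (model L).F (auxPolyT L c D L₁ m α p) (gpt c m Y K + t • dir c m) =
      (model L).lam α (gpt c m Y K + t • dir c m) (bpt L c m) ^ D * auxF L c D L₁ p (Y + L.ω₁ / 2 + t) := by
  rw [auxPolyT, (model L).F_translForm α _ (auxPolyF_isHomogeneous D L₁ m p), F_auxPolyF,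
    show gpt c m Y K + t • dir c m + bpt L c m = gpt c m Y K + bpt L c m + t • dir c m by abel,
    gpt_add_bpt_add_smul_dir, thetaEval_auxPoly_eq_auxF L c hmL p _ (by simpa using cexp_mul_coord c hm _ K) rfl]
  rfl

/-- **Vanishing transfer**: if `F_p` vanishes to order `≥ T₁` at `ω₁/2 + Y` then `F_{P̃'}` vanishes to
order `≥ T₁` along `ℂ x₀` at `σ = (cY/m + 2πiK/m, Y, Y)`. [folklore] -/
theorem vanishesToOrder_auxPolyT (hm : 1 ≤ m) (hmL : m * L₁ ≤ D) (α : Fin (model L).nLaw) (p : Coeff D L₁ → ℂ)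
    (Y : ℂ) (K : ℕ) {T₁ : ℕ} (hvan : ∀ k < T₁, iteratedDeriv k (auxF L c D L₁ p) (L.ω₁ / 2 + Y) = 0) :
    VanishesToOrder (ℂ ∙ dir c m) ((model L).F (auxPolyT L c D L₁ m α p)) (gpt c m Y K) T₁ := by
  intro x hx k hk
  obtain ⟨a, rfl⟩ := Submodule.mem_span_singleton.mp hx
  set G : ℂ → ℂ := fun u => (model L).F (auxPolyT L c D L₁ m α p) (gpt c m Y K + u • dir c m) with hG
  have hGan : ∀ u, AnalyticAt ℂ G u := fun u => (model L).analyticAt_F_line _ _ _ u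
  have hGd : Differentiable ℂ G := fun u => (hGan u).differentiableAt
  have hGcd : ContDiff ℂ k G := hGd.contDiff
  -- the function along `a • x₀` is `G (a t)`
  have hcomp : (fun t : ℂ => (model L).F (auxPolyT L c D L₁ m α p) (gpt c m Y K + t • (a • dir c m))) =
      fun t => G (a * t) := by
    funext t; simp only [hG, smul_smul, mul_comm t a]
  rw [hcomp, iteratedDeriv_comp_const_mul hGcd a]
  show a ^ k * iteratedDeriv k G (a * 0) = 0
  rw [mul_zero]
  -- `G = g · f` with `f(u) = F_p(ω₁/2 + Y + u)` vanishing to order `T₁` at `0`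
  set f : ℂ → ℂ := fun u => auxF L c D L₁ p (L.ω₁ / 2 + Y + u) with hf
  set g : ℂ → ℂ := fun u => (model L).lam α (gpt c m Y K + u • dir c m) (bpt L c m) ^ D with hg
  have hGfg : G = fun u => g u * f u := by
    funext u
    simp only [hG, hg, hf, F_auxPolyT_line L c hm hmL α p Y K u]
    ring_nf
  have hfan : AnalyticAt ℂ f 0 :=
    ((differentiable_auxF L c D L₁ p).comp ((differentiable_const _).add differentiable_id)).analyticAt 0
  have hgan : AnalyticAt ℂ g 0 := by
    have h1 : AnalyticAt ℂ (Function.uncurry ((model L).lam α)) (gpt c m Y K + (0 : ℂ) • dir c m, bpt L c m) :=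
      (model L).analyticOnNhd_lam α _ trivial
    have h2 : AnalyticAt ℂ (fun u : ℂ => (gpt c m Y K + u • dir c m, bpt L c m)) 0 :=
      (analyticAt_const.add (analyticAt_id.smul analyticAt_const)).prod analyticAt_const
    exact (AnalyticAt.comp (g := Function.uncurry ((model L).lam α))
      (f := fun u : ℂ => (gpt c m Y K + u • dir c m, bpt L c m)) (x := 0) h1 h2).pow D
  have hfvan : ∀ j < T₁, iteratedDeriv j f 0 = 0 := fun j hj => by
    have := congr_fun (iteratedDeriv_comp_const_add j (auxF L c D L₁ p) (L.ω₁ / 2 + Y)) 0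
    rw [hf, this, add_zero]
    exact hvan j hj
  have := AnalyticGroupModel.forall_iteratedDeriv_mul_eq_zero hfan hgan hfvan k hk
  rw [hGfg, this, mul_zero]

end Model


/-! ### The auxiliary form does not vanish identically on `M₀` -/

/-- **Off the lattice the theta value is `σ(z)^{3D} · ∑ p_{ijk} (e^y)^{mj} sⁱ ℘(z)ᵏ`.** [folklore] -/
theorem thetaEval_auxPoly_pt (L : PeriodPair) {D L₁ m : ℕ} (hmL : m * L₁ ≤ D) (p : Coeff D L₁ → ℂ) (y s : ℂ)
    {z : ℂ} (hz : z ∉ L.lattice) :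
    thetaEval L κ0 (auxPoly D L₁ m p) (pt y z s) = L.weierstrassSigma z ^ (3 * D) *
      ∑ ijk : Coeff D L₁, p ijk * (cexp y ^ (m * ijk.2.1) * s ^ (ijk.1 : ℕ) * ℘[L] z ^ (ijk.2.2 : ℕ)) := by
  rw [thetaEval_auxPoly L hmL, Finset.mul_sum]
  refine Finset.sum_congr rfl fun ijk _ => ?_
  obtain ⟨h0, h1, -⟩ := PeriodPair.univExtP_eq hz
  simp only [pt_iy, pt_is, pt_iz, h0, h1]
  have hk : (ijk.2.2 : ℕ) ≤ D := Nat.le_of_lt_succ ijk.2.2.isLt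
  have hpow : (L.weierstrassSigma z ^ 3 * ℘[L] z) ^ (ijk.2.2 : ℕ) * (L.weierstrassSigma z ^ 3) ^ (D - ijk.2.2) =
      L.weierstrassSigma z ^ (3 * D) * ℘[L] z ^ (ijk.2.2 : ℕ) := by
    rw [mul_pow, ← pow_mul, ← pow_mul, show L.weierstrassSigma z ^ (3 * (ijk.2.2 : ℕ)) * ℘[L] z ^ (ijk.2.2 : ℕ) *
      L.weierstrassSigma z ^ (3 * (D - ijk.2.2)) = L.weierstrassSigma z ^ (3 * (ijk.2.2 : ℕ) + 3 * (D - ijk.2.2)) *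
        ℘[L] z ^ (ijk.2.2 : ℕ) by ring, ← Nat.mul_add, Nat.add_sub_cancel' hk]
  rw [hpow]; ring

/-- `℘` takes infinitely many values off the lattice (open mapping at `ω₁/2`). [folklore] -/
theorem infinite_image_weierstrassP (L : PeriodPair) : (℘[L] '' (L.lattice : Set ℂ)ᶜ).Infinite := by
  obtain ⟨δ, hδ, -, hball⟩ := Chudnovsky.exists_closedBall_subset_compl_lattice L
  have han : AnalyticAt ℂ ℘[L] (L.ω₁ / 2) := L.analyticOnNhd_weierstrassP _ L.ω₁_div_two_notMem_lattice
  have hle := (han.eventually_constant_or_nhds_le_map_nhds).resolve_left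
    (Chudnovsky.not_eventually_const_weierstrassP L)
  have hmem : ℘[L] '' Metric.closedBall (L.ω₁ / 2) δ ∈ 𝓝 (℘[L] (L.ω₁ / 2)) :=
    hle (Filter.image_mem_map (Metric.closedBall_mem_nhds _ hδ))
  obtain ⟨ρ, hρ, hsub⟩ := Metric.mem_nhds_iff.mp hmem
  have hsub' : Metric.ball (℘[L] (L.ω₁ / 2)) ρ ⊆ ℘[L] '' (L.lattice : Set ℂ)ᶜ :=
    hsub.trans (Set.image_mono hball)
  refine Set.Infinite.mono hsub' ?_
  -- the points `e₁ + ρ/(n+2)` are distinct and in the ball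
  refine Set.infinite_of_injective_forall_mem (f := fun n : ℕ => ℘[L] (L.ω₁ / 2) + (ρ / (n + 2) : ℝ)) ?_ ?_
  · intro a b hab
    have h0 := add_left_cancel hab
    have h1 : (ρ / (a + 2) : ℝ) = ρ / (b + 2) := by exact_mod_cast h0
    have ha : (0 : ℝ) < a + 2 := by positivity
    have hb : (0 : ℝ) < b + 2 := by positivity
    field_simp at h1
    exact_mod_cast (by linarith : (a : ℝ) = b)
  · intro n
    rw [Metric.mem_ball, dist_eq_norm, add_sub_cancel_left, Complex.norm_real, Real.norm_eq_abs,
      abs_of_pos (by positivity)]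
    have : (0 : ℝ) < n + 2 := by positivity
    rw [div_lt_iff₀ this]; nlinarith

/-- A complex polynomial vanishing on an infinite set of complex numbers is zero, coefficientwise.
[folklore] -/
theorem coeff_eq_zero_of_eval_eq_zero {q : Polynomial ℂ} {S : Set ℂ} (hS : S.Infinite)
    (h : ∀ x ∈ S, q.eval x = 0) (n : ℕ) : q.coeff n = 0 := by
  have : q = 0 := Polynomial.eq_zero_of_infinite_isRoot q (hS.mono fun x hx => h x hx)
  rw [this, Polynomial.coeff_zero]

/-- **Linear independence of the functions `(e^y)^{mj} sⁱ σ(z)^{3D}℘(z)ᵏ` on `ℂ³`**: if the theta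
value of the auxiliary form vanishes identically then all its coefficients vanish (`m ≥ 1`).
[folklore] -/
theorem coeff_eq_zero_of_thetaEval_eq_zero (L : PeriodPair) {D L₁ m : ℕ} (hm : 1 ≤ m) (hmL : m * L₁ ≤ D)
    {p : Coeff D L₁ → ℂ} (h : ∀ w, thetaEval L κ0 (auxPoly D L₁ m p) w = 0) : p = 0 := by
  -- Step A: off the lattice the affine sum vanishes
  have hA : ∀ (y s z : ℂ), z ∉ L.lattice →
      ∑ ijk : Coeff D L₁, p ijk * (cexp y ^ (m * ijk.2.1) * s ^ (ijk.1 : ℕ) * ℘[L] z ^ (ijk.2.2 : ℕ)) = 0 := by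
    intro y s z hz
    have := h (pt y z s)
    rw [thetaEval_auxPoly_pt L hmL p y s hz] at this
    exact (mul_eq_zero.mp this).resolve_left (pow_ne_zero _ (L.weierstrassSigma_ne_zero hz))
  -- Step B: the coefficient of `℘ᵏ`
  have hB : ∀ (y s : ℂ) (k : Fin (D + 1)),
      ∑ i : Fin (D + 1), ∑ j : Fin (L₁ + 1), p (i, j, k) * (cexp y ^ (m * j) * s ^ (i : ℕ)) = 0 := by
    intro y s k
    set q : Polynomial ℂ := ∑ ijk : Coeff D L₁,
      Polynomial.C (p ijk * (cexp y ^ (m * ijk.2.1) * s ^ (ijk.1 : ℕ))) * Polynomial.X ^ (ijk.2.2 : ℕ) with hq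
    have hev : ∀ x ∈ ℘[L] '' (L.lattice : Set ℂ)ᶜ, q.eval x = 0 := by
      rintro x ⟨z, hz, rfl⟩
      rw [hq, Polynomial.eval_finsetSum]
      simp only [Polynomial.eval_mul, Polynomial.eval_C, Polynomial.eval_pow, Polynomial.eval_X]
      rw [← hA y s z hz]
      refine Finset.sum_congr rfl fun ijk _ => by ring
    have hc := coeff_eq_zero_of_eval_eq_zero (infinite_image_weierstrassP L) hev k
    rw [hq, Polynomial.finsetSum_coeff] at hc
    simp only [Polynomial.coeff_C_mul, Polynomial.coeff_X_pow] at hc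
    have hre : (∑ x : Coeff D L₁, p x * (cexp y ^ (m * ↑x.2.1) * s ^ (x.1 : ℕ)) * if (k : ℕ) = ↑x.2.2 then 1 else 0) =
        ∑ i : Fin (D + 1), ∑ j : Fin (L₁ + 1), p (i, j, k) * (cexp y ^ (m * j) * s ^ (i : ℕ)) := by
      rw [Fintype.sum_prod_type]
      refine Finset.sum_congr rfl fun i _ => ?_
      rw [Fintype.sum_prod_type]
      refine Finset.sum_congr rfl fun j _ => ?_
      rw [Finset.sum_eq_single k (fun k' _ hk' => by rw [if_neg (fun h => hk' (Fin.ext h).symm), mul_zero])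
        (fun hk => absurd (Finset.mem_univ k) hk), if_pos rfl, mul_one]
    rw [hre] at hc
    exact hc
  -- Step C: the coefficient of `sⁱ`
  have hC : ∀ (y : ℂ) (k i : Fin (D + 1)), ∑ j : Fin (L₁ + 1), p (i, j, k) * cexp y ^ (m * j) = 0 := by
    intro y k i
    set q : Polynomial ℂ := ∑ i : Fin (D + 1), Polynomial.C (∑ j : Fin (L₁ + 1), p (i, j, k) * cexp y ^ (m * j)) *
      Polynomial.X ^ (i : ℕ) with hq
    have hev : ∀ x ∈ (Set.univ : Set ℂ), q.eval x = 0 := by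
      rintro x -
      rw [hq, Polynomial.eval_finsetSum]
      simp only [Polynomial.eval_mul, Polynomial.eval_C, Polynomial.eval_pow, Polynomial.eval_X]
      rw [← hB y x k]
      refine Finset.sum_congr rfl fun i _ => ?_
      rw [Finset.sum_mul]
      refine Finset.sum_congr rfl fun j _ => by ring
    have hc := coeff_eq_zero_of_eval_eq_zero Set.infinite_univ hev i
    rw [hq, Polynomial.finsetSum_coeff] at hc
    simp only [Polynomial.coeff_C_mul, Polynomial.coeff_X_pow] at hc
    rw [Finset.sum_eq_single i (fun i' _ hi' => by rw [if_neg (fun h => hi' (Fin.ext h).symm), mul_zero])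
      (fun hi => absurd (Finset.mem_univ i) hi), if_pos rfl, mul_one] at hc
    exact hc
  -- Step D: the coefficient of `(e^{my})ʲ`: the values `e^{my}`, `y ∈ ℝ`, are infinitely many
  funext ⟨i, j, k⟩
  set q : Polynomial ℂ := ∑ j : Fin (L₁ + 1), Polynomial.C (p (i, j, k)) * Polynomial.X ^ (j : ℕ) with hq
  have hS : (Set.range fun t : ℝ => (Real.exp t : ℂ)).Infinite := by
    refine Set.infinite_range_of_injective fun a b hab => ?_
    have := congrArg Complex.re hab
    simp only [Complex.ofReal_re] at this
    exact Real.exp_injective this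
  have hev : ∀ x ∈ Set.range (fun t : ℝ => (Real.exp t : ℂ)), q.eval x = 0 := by
    rintro x ⟨t, rfl⟩
    have hm0 : (m : ℂ) ≠ 0 := by exact_mod_cast (show m ≠ 0 by omega)
    have hy : cexp ((t : ℂ) / m) ^ m = (Real.exp t : ℂ) := by
      rw [← Complex.exp_nat_mul, mul_div_cancel₀ _ hm0, Complex.ofReal_exp]
    rw [hq, Polynomial.eval_finsetSum]
    simp only [Polynomial.eval_mul, Polynomial.eval_C, Polynomial.eval_pow, Polynomial.eval_X]
    rw [← hC ((t : ℂ) / m) k i]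
    refine Finset.sum_congr rfl fun j _ => ?_
    rw [pow_mul, hy]
  have hc := coeff_eq_zero_of_eval_eq_zero hS hev j
  rw [hq, Polynomial.finsetSum_coeff] at hc
  simp only [Polynomial.coeff_C_mul, Polynomial.coeff_X_pow] at hc
  rw [Finset.sum_eq_single j (fun j' _ hj' => by rw [if_neg (fun h => hj' (Fin.ext h).symm), mul_zero])
    (fun hj => absurd (Finset.mem_univ j) hj), if_pos rfl, mul_one] at hc
  exact hc

section Model

variable (L : PeriodPair) (c : ℂ) {D L₁ m : ℕ}

/-- **`F_{P̃'} ≢ 0` for a non-zero coefficient family**, for a suitable addition law `α` (one whose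
unit `λ^α(0, b) ≠ 0`; the product of two non-zero entire functions on `ℂ³` is non-zero). [folklore] -/
theorem exists_F_auxPolyT_ne_zero (hm : 1 ≤ m) (hmL : m * L₁ ≤ D) {p : Coeff D L₁ → ℂ} (hp : p ≠ 0) :
    ∃ α : Fin (model L).nLaw, ∃ w, (model L).F (auxPolyT L c D L₁ m α p) w ≠ 0 := by
  obtain ⟨α, hα⟩ := (model L).exists_lam_ne_zero 0 (bpt L c m)
  refine ⟨α, ?_⟩
  by_contra hcon
  push Not at hcon
  have hF : ∀ w, (model L).lam α w (bpt L c m) ^ D * (model L).F (auxPolyF D L₁ m p) (w + bpt L c m) = 0 := by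
    intro w
    rw [← (model L).F_translForm α _ (auxPolyF_isHomogeneous D L₁ m p)]
    exact hcon w
  have hf : AnalyticOnNhd ℂ (fun w : V3 => (model L).lam α w (bpt L c m) ^ D) univ := by
    intro w _
    have h1 : AnalyticAt ℂ (Function.uncurry ((model L).lam α)) (w, bpt L c m) := (model L).analyticOnNhd_lam α _ trivial
    have h2 : AnalyticAt ℂ (fun w : V3 => (w, bpt L c m)) w := analyticAt_id.prod analyticAt_const
    exact (AnalyticAt.comp (g := Function.uncurry ((model L).lam α)) (f := fun w : V3 => (w, bpt L c m)) (x := w) h1 h2).pow D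
  have hg : AnalyticOnNhd ℂ (fun w : V3 => (model L).F (auxPolyF D L₁ m p) (w + bpt L c m)) univ := by
    intro w _
    exact ((model L).analyticOnNhd_F _ _ trivial).comp (analyticAt_id.add analyticAt_const)
  rcases eq_zero_or_eq_zero_of_mul_eq_zero hf hg hF with h0 | h0
  · exact hα (pow_eq_zero_iff (n := D) (by
      rintro rfl
      simp at h0
      ) |>.mp (by simpa using h0 0))
  · apply hp
    refine coeff_eq_zero_of_thetaEval_eq_zero L hm hmL fun w => ?_
    have := h0 (w - bpt L c m)
    rwa [sub_add_cancel, F_auxPolyF] at this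

end Model


/-! ### The subgroups `exp⁻¹(G')` of `Lie M₀` and the count `card((Σ + G')/G')` -/

section Subgroups

variable (L : PeriodPair)

/-- **`ker(exp_{M₀}) = 2πiℤ × Λ × 0`** as an additive subgroup of `Lie M₀`. [folklore] -/
def kerSub : AddSubgroup V3 where
  carrier := {w | (∃ q : ℤ, w (iy ()) = q * (2 * Real.pi * I)) ∧ w (iz ()) ∈ L.lattice ∧ w (is ()) = 0}
  zero_mem' := ⟨⟨0, by simp⟩, L.lattice.zero_mem, rfl⟩
  add_mem' := by
    rintro v w ⟨⟨q, hq⟩, hz, hs⟩ ⟨⟨q', hq'⟩, hz', hs'⟩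
    exact ⟨⟨q + q', by simp only [Pi.add_apply, hq, hq', Int.cast_add]; ring⟩, L.lattice.add_mem hz hz',
      by simp [hs, hs']⟩
  neg_mem' := by
    rintro w ⟨⟨q, hq⟩, hz, hs⟩
    exact ⟨⟨-q, by simp only [Pi.neg_apply, hq, Int.cast_neg]; ring⟩, L.lattice.neg_mem hz, by simp [hs]⟩

/-- Membership in `kerSub`. [folklore] -/
theorem mem_kerSub_iff (w : V3) : w ∈ kerSub L ↔
    (∃ q : ℤ, w (iy ()) = q * (2 * Real.pi * I)) ∧ w (iz ()) ∈ L.lattice ∧ w (is ()) = 0 := Iff.rfl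

/-- `GaGmE.Std.ker L 0` is `kerSub L`. [folklore] -/
theorem ker_eq : GaGmE.Std.ker L κ0 = (kerSub L : Set V3) := by
  ext w
  simp only [GaGmE.Std.ker, Set.mem_setOf_eq, SetLike.mem_coe, mem_kerSub_iff]
  constructor
  · rintro ⟨hy, m, n, hz, hs⟩
    exact ⟨hy (), PeriodPair.mem_lattice.mpr ⟨m (), n (), (hz ()).symm⟩, by simpa using hs ()⟩
  · rintro ⟨hy, hz, hs⟩
    obtain ⟨m, n, hmn⟩ := PeriodPair.mem_lattice.mp hz
    exact ⟨fun j => by cases j; exact hy, fun _ => m, fun _ => n, fun b => by cases b; exact hmn.symm,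
      fun e => by cases e; simpa using hs⟩

/-- `closure(ker) = kerSub`. [folklore] -/
theorem closure_ker : AddSubgroup.closure (GaGmE.Std.ker L κ0) = kerSub L := by
  rw [ker_eq, AddSubgroup.closure_eq]

/-- Linear conditions indexed by a `ℚ`-subspace of `ℚ^{Unit}`: all of them hold iff the subspace is
`0` or the coordinate vanishes. [folklore] -/
theorem forall_rat_mul_eq_zero_iff (A : Submodule ℚ (Unit → ℚ)) (x : Unit → ℂ) :
    (∀ q ∈ A, ∑ j : Unit, (q j : ℂ) * x j = 0) ↔ (A ≠ ⊥ → x () = 0) := by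
  simp only [Finset.univ_unique, Finset.sum_singleton, PUnit.default_eq_unit]
  constructor
  · intro h hA
    obtain ⟨q, hqA, hq0⟩ := (Submodule.ne_bot_iff A).mp hA
    have hq : q () ≠ 0 := fun h0 => hq0 (funext fun u => by cases u; exact h0)
    have := h q hqA
    exact (mul_eq_zero.mp this).resolve_left (by exact_mod_cast hq)
  · intro h q hq
    by_cases hq0 : q = 0
    · simp [hq0]
    · rw [h ((Submodule.ne_bot_iff A).mpr ⟨q, hq, hq0⟩), mul_zero]

/-- The same for a `ℂ`-subspace of `ℂ^{Unit}`. [folklore] -/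
theorem forall_cpx_mul_eq_zero_iff (Ξ : Submodule ℂ (Unit → ℂ)) (x : Unit → ℂ) :
    (∀ ξ ∈ Ξ, ∑ e : Unit, ξ e * x e = 0) ↔ (Ξ ≠ ⊥ → x () = 0) := by
  simp only [Finset.univ_unique, Finset.sum_singleton, PUnit.default_eq_unit]
  constructor
  · intro h hΞ
    obtain ⟨ξ, hξ, hξ0⟩ := (Submodule.ne_bot_iff Ξ).mp hΞ
    have hq : ξ () ≠ 0 := fun h0 => hξ0 (funext fun u => by cases u; exact h0)
    exact (mul_eq_zero.mp (h ξ hξ)).resolve_left hq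
  · intro h ξ hξ
    by_cases h0 : ξ = 0
    · simp [h0]
    · rw [h ((Submodule.ne_bot_iff Ξ).mpr ⟨ξ, hξ, h0⟩), mul_zero]

/-- **`Lie G'` for `M₀`**: the tangent space of the subgroup datum `K = (A, C, Ξ)` is cut out by
`y = 0` if `A ≠ 0`, `z = 0` if `C ≠ 0`, `s = 0` if `Ξ ≠ 0`. [folklore] -/
theorem mem_tangent_iff' (K : SubgroupDataC Unit Unit Unit κ0) (w : V3) :
    w ∈ K.tangent ↔ (K.A ≠ ⊥ → w (iy ()) = 0) ∧ (K.C ≠ ⊥ → w (iz ()) = 0) ∧ (K.Ξ ≠ ⊥ → w (is ()) = 0) := by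
  rw [SubgroupDataC.mem_tangent_iff, forall_rat_mul_eq_zero_iff K.A fun j => w (iy j),
    forall_rat_mul_eq_zero_iff K.C fun b => w (iz b), forall_cpx_mul_eq_zero_iff K.Ξ fun e => w (is e)]

/-- **Membership in `exp⁻¹(G') = Lie G' + ker`.** [folklore] -/
theorem pt_mem_preimage_iff (K : SubgroupDataC Unit Unit Unit κ0) (u v v' : ℂ) :
    pt u v v' ∈ preimageSubgroup L κ0 K ↔
      (K.A ≠ ⊥ → ∃ q : ℤ, u = q * (2 * Real.pi * I)) ∧ (K.C ≠ ⊥ → v ∈ L.lattice) ∧ (K.Ξ ≠ ⊥ → v' = 0) := by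
  rw [preimageSubgroup, closure_ker, AddSubgroup.mem_sup]
  constructor
  · rintro ⟨t, ht, k, hk, htk⟩
    rw [Submodule.mem_toAddSubgroup, mem_tangent_iff'] at ht
    obtain ⟨⟨q, hq⟩, hz, hs⟩ := hk
    obtain ⟨hA, hC, hΞ⟩ := ht
    have ey : t (iy ()) + k (iy ()) = u := by simpa using congr_fun htk (iy ())
    have ez : t (iz ()) + k (iz ()) = v := by simpa using congr_fun htk (iz ())
    have es : t (is ()) + k (is ()) = v' := by simpa using congr_fun htk (is ())
    refine ⟨fun h => ⟨q, ?_⟩, fun h => ?_, fun h => ?_⟩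
    · rw [← ey, hA h, zero_add, hq]
    · rw [← ez, hC h, zero_add]; exact hz
    · rw [← es, hΞ h, hs, add_zero]
  · rintro ⟨hA, hC, hΞ⟩
    classical
    set ky : ℂ := if K.A = ⊥ then 0 else u with hky
    set kz : ℂ := if K.C = ⊥ then 0 else v with hkz
    refine ⟨pt (u - ky) (v - kz) v', ?_, pt ky kz 0, ?_, by rw [pt_add]; simp⟩
    · rw [Submodule.mem_toAddSubgroup, mem_tangent_iff']
      refine ⟨fun h => ?_, fun h => ?_, fun h => ?_⟩
      · simp [hky, h]
      · simp [hkz, h]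
      · simpa using hΞ h
    · refine ⟨?_, ?_, rfl⟩
      · by_cases h : K.A = ⊥
        · exact ⟨0, by simp [hky, h]⟩
        · obtain ⟨q, hq⟩ := hA h
          exact ⟨q, by simp [hky, h, hq]⟩
      · by_cases h : K.C = ⊥
        · simp [hkz, h]
        · simpa [hkz, h] using hC h

/-- Differences of the points `σ`. [folklore] -/
theorem neg_gpt_add_gpt (c : ℂ) (m : ℕ) (Y Y' : ℂ) (K K' : ℕ) :
    -gpt c m Y K + gpt c m Y' K' =
      pt (c * (Y' - Y) / m + 2 * Real.pi * I * ((K' : ℂ) - K) / m) (Y' - Y) (Y' - Y) := by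
  rw [gpt, gpt, neg_pt, pt_add]
  congr 1 <;> ring

/-- `2πi(K' - K)/m ∈ 2πiℤ` with `K, K' < m` forces `K = K'`. [folklore] -/
theorem eq_of_torsion {m K K' : ℕ} (hK : K < m) (hK' : K' < m) {q : ℤ}
    (h : 2 * Real.pi * I * ((K' : ℂ) - K) / m = q * (2 * Real.pi * I)) : K = K' := by
  have hm0 : (m : ℂ) ≠ 0 := by exact_mod_cast (show m ≠ 0 by omega)
  have hπ : (2 * Real.pi * I : ℂ) ≠ 0 := by simp [Real.pi_ne_zero, Complex.I_ne_zero]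
  have h1 : ((K' : ℂ) - K) = q * m := by
    field_simp at h
    linear_combination h
  have h2 : ((K' : ℤ) - K : ℤ) = q * m := by exact_mod_cast h1
  have hlt : ((K' : ℤ) - K) < m := by omega
  have hgt : -(m : ℤ) < (K' : ℤ) - K := by omega
  rcases lt_trichotomy q 0 with hq | rfl | hq
  · nlinarith
  · omega
  · nlinarith

/-- A relation `c(Y' - Y)/m + 2πi(K' - K)/m ∈ 2πiℤ` gives `e^{cY'} = e^{cY}`. [folklore] -/
theorem cexp_eq_of_rel (c : ℂ) {m : ℕ} (hm : 1 ≤ m) {Y Y' : ℂ} {K K' : ℕ} {q : ℤ}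
    (h : c * (Y' - Y) / m + 2 * Real.pi * I * ((K' : ℂ) - K) / m = q * (2 * Real.pi * I)) :
    cexp (c * Y') = cexp (c * Y) := by
  have hm0 : (m : ℂ) ≠ 0 := by exact_mod_cast (show m ≠ 0 by omega)
  have h1 : c * Y' = c * Y + ((q * m : ℤ) * (2 * Real.pi * I) + ((K : ℤ) - K' : ℤ) * (2 * Real.pi * I)) := by
    have := congrArg (fun x => (m : ℂ) * x) h
    simp only [mul_add] at this
    rw [mul_div_cancel₀ _ hm0, mul_div_cancel₀ _ hm0] at this
    push_cast
    linear_combination this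
  rw [h1, Complex.exp_add, Complex.exp_add, Complex.exp_int_mul_two_pi_mul_I, Complex.exp_int_mul_two_pi_mul_I]
  simp

/-- Distinct second indices give distinct `𝔾ₘ`-coordinates when `‖e^{cω₂}‖ ≠ 1`. [cite: Tubbs1990, proof of Cor. 5.2 (p. 126)] -/
theorem eq_of_cexp_latt_eq (c : ℂ) (hB : ‖cexp (c * L.ω₂)‖ ≠ 1) {n₂ n₂' : ℕ}
    (h : cexp (c * latt L 0 n₂') = cexp (c * latt L 0 n₂)) : n₂ = n₂' := by
  have key : ∀ n : ℕ, cexp (c * latt L 0 n) = cexp (c * L.ω₂) ^ n := fun n => by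
    rw [← Complex.exp_nat_mul, latt]; push_cast; ring_nf
  rw [key, key] at h
  have hn := congrArg (fun x : ℂ => ‖x‖) h
  simp only [norm_pow] at hn
  exact (pow_right_injective₀ (norm_pos_iff.mpr (Complex.exp_ne_zero _)) hB hn).symm

/-- An injection into a finite set bounds the number of classes from below. [folklore] -/
theorem card_le_ncard_image {ι α β : Type*} [Fintype ι] {S : Set α} (hS : S.Finite) (g : α → β) (f : ι → α)
    (hf : ∀ i, f i ∈ S) (hinj : Function.Injective (g ∘ f)) : Fintype.card ι ≤ (g '' S).ncard := by
  calc Fintype.card ι = (Set.range (g ∘ f)).ncard := by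
        rw [Set.ncard_range_of_injective hinj, Nat.card_eq_fintype_card]
    _ ≤ (g '' S).ncard := Set.ncard_le_ncard (by rintro _ ⟨i, rfl⟩; exact ⟨f i, hf i, rfl⟩) (hS.image g)

variable (c : ℂ)

/-- **Count for `G' ⊆ 𝔾ₘ × E` (`Ξ ≠ 0`)**: `card((Σ + G')/G') ≥ X²`. [folklore] -/
theorem sq_le_ncard_of_Ξ (K : SubgroupDataC Unit Unit Unit κ0) (hΞ : K.Ξ ≠ ⊥) (m X : ℕ) (hm : 1 ≤ m) :
    X ^ 2 ≤ ((QuotientAddGroup.mk : V3 → V3 ⧸ preimageSubgroup L κ0 K) '' pts L c m X).ncard := by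
  have h := card_le_ncard_image (pts_finite L c m X) (QuotientAddGroup.mk : V3 → V3 ⧸ preimageSubgroup L κ0 K)
    (fun n : Fin X × Fin X => gpt c m (latt L n.1 n.2) 0) (fun n => ⟨(n.1, n.2, ⟨0, hm⟩), rfl⟩) ?_
  · simpa [sq] using h
  · intro n n' hnn'
    have hmem := QuotientAddGroup.eq.mp hnn'
    rw [neg_gpt_add_gpt, pt_mem_preimage_iff] at hmem
    have hY := sub_eq_zero.mp (hmem.2.2 hΞ)
    obtain ⟨h1, h2⟩ := latt_injective L hY
    exact Prod.ext (Fin.ext h1.symm) (Fin.ext h2.symm)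

/-- **Count for `G' ⊆ E` (`A ≠ 0`, `Ξ ≠ 0`)**: `card((Σ + G')/G') ≥ m X²`. [folklore] -/
theorem mul_sq_le_ncard_of_A_Ξ (K : SubgroupDataC Unit Unit Unit κ0) (hA : K.A ≠ ⊥) (hΞ : K.Ξ ≠ ⊥) (m X : ℕ) :
    m * X ^ 2 ≤ ((QuotientAddGroup.mk : V3 → V3 ⧸ preimageSubgroup L κ0 K) '' pts L c m X).ncard := by
  have h := card_le_ncard_image (pts_finite L c m X) (QuotientAddGroup.mk : V3 → V3 ⧸ preimageSubgroup L κ0 K)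
    (fun q : Fin X × Fin X × Fin m => gpt c m (latt L q.1 q.2.1) q.2.2) (fun q => ⟨q, rfl⟩) ?_
  · simpa [sq, mul_comm, mul_assoc, mul_left_comm] using h
  · intro q q' hqq'
    have hmem := QuotientAddGroup.eq.mp hqq'
    rw [neg_gpt_add_gpt, pt_mem_preimage_iff] at hmem
    have hY := sub_eq_zero.mp (hmem.2.2 hΞ)
    obtain ⟨h1, h2⟩ := latt_injective L hY
    obtain ⟨r, hr⟩ := hmem.1 hA
    rw [hY, sub_self, mul_zero, zero_div, zero_add] at hr
    have h3 := eq_of_torsion q.2.2.isLt q'.2.2.isLt hr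
    exact Prod.ext (Fin.ext h1.symm) (Prod.ext (Fin.ext h2.symm) (Fin.ext h3))

/-- **Count for `G' ∌ 𝔾ₘ` (`A ≠ 0`)**: `card((Σ + G')/G') ≥ m X`, using `‖e^{cω₂}‖ ≠ 1`.
[cite: Tubbs1990, proof of Cor. 5.2 (p. 126)] -/
theorem mul_le_ncard_of_A (hB : ‖cexp (c * L.ω₂)‖ ≠ 1) (K : SubgroupDataC Unit Unit Unit κ0) (hA : K.A ≠ ⊥)
    {m : ℕ} (hm : 1 ≤ m) (X : ℕ) (hX : 1 ≤ X) :
    m * X ≤ ((QuotientAddGroup.mk : V3 → V3 ⧸ preimageSubgroup L κ0 K) '' pts L c m X).ncard := by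
  have h := card_le_ncard_image (pts_finite L c m X) (QuotientAddGroup.mk : V3 → V3 ⧸ preimageSubgroup L κ0 K)
    (fun q : Fin X × Fin m => gpt c m (latt L 0 q.1) q.2) (fun q => ⟨(⟨0, hX⟩, q.1, q.2), by simp⟩) ?_
  · simpa [mul_comm] using h
  · intro q q' hqq'
    have hmem := QuotientAddGroup.eq.mp hqq'
    rw [neg_gpt_add_gpt, pt_mem_preimage_iff] at hmem
    obtain ⟨r, hr⟩ := hmem.1 hA
    have hexp := cexp_eq_of_rel c hm hr
    have h1 : (q.1 : ℕ) = q'.1 := eq_of_cexp_latt_eq L c hB hexp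
    have hY : latt L 0 q'.1 = latt L 0 q.1 := by rw [h1]
    rw [hY, sub_self, mul_zero, zero_div, zero_add] at hr
    have h3 := eq_of_torsion q.2.isLt q'.2.isLt hr
    exact Prod.ext (Fin.ext h1) (Fin.ext h3)

/-- **Trivial count**: `card((Σ + G')/G') ≥ 1`. [folklore] -/
theorem one_le_ncard (K : SubgroupDataC Unit Unit Unit κ0) {m X : ℕ} (hm : 1 ≤ m) (hX : 1 ≤ X) :
    1 ≤ ((QuotientAddGroup.mk : V3 → V3 ⧸ preimageSubgroup L κ0 K) '' pts L c m X).ncard :=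
  (Set.ncard_pos ((pts_finite L c m X).image _)).mpr ⟨_, 0, zero_mem_pts L c hm hX, rfl⟩

/-- **The lines `ℂx₀` meet `Lie G'` trivially** unless `G' = M₀` (`c ≠ 0`, `m ≥ 1`). [folklore] -/
theorem span_dir_inf_tangent {c : ℂ} (hc : c ≠ 0) {m : ℕ} (hm : 1 ≤ m) (K : SubgroupDataC Unit Unit Unit κ0)
    (hK : K.A ≠ ⊥ ∨ K.C ≠ ⊥ ∨ K.Ξ ≠ ⊥) : (ℂ ∙ dir c m) ⊓ K.tangent = ⊥ := by
  rw [Submodule.eq_bot_iff]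
  intro x hx'
  obtain ⟨hx, hxK⟩ := Submodule.mem_inf.mp hx'
  obtain ⟨a, rfl⟩ := Submodule.mem_span_singleton.mp hx
  rw [dir, smul_pt, mem_tangent_iff'] at hxK
  simp only [pt_iy, pt_iz, pt_is, mul_one] at hxK
  have hm0 : (m : ℂ) ≠ 0 := by exact_mod_cast (show m ≠ 0 by omega)
  have ha : a = 0 := by
    rcases hK with h | h | h
    · have := hxK.1 h
      field_simp at this
      simpa [hc] using this
    · exact hxK.2.1 h
    · exact hxK.2.2 h
  rw [ha, zero_smul]

/-- `Lie M₀ ⊆ Lie G'` when all three constraints are absent. [folklore] -/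
theorem tangent_eq_top (K : SubgroupDataC Unit Unit Unit κ0) (hA : K.A = ⊥) (hC : K.C = ⊥) (hΞ : K.Ξ = ⊥) :
    K.tangent = ⊤ := by
  rw [eq_top_iff]
  rintro w -
  rw [mem_tangent_iff']
  exact ⟨fun h => absurd hA h, fun h => absurd hC h, fun h => absurd hΞ h⟩

/-- Lower bound `1 ≤ dim Lie G'` from one non-zero tangent vector. [folklore] -/
theorem one_le_finrank_of_mem {T : Submodule ℂ V3} {v : V3} (hv : v ∈ T) (hv0 : v ≠ 0) : 1 ≤ finrank ℂ T := by
  rw [Submodule.one_le_finrank_iff, Submodule.ne_bot_iff]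
  exact ⟨v, hv, hv0⟩

/-- Lower bound `2 ≤ dim Lie G'` from two independent tangent vectors. [folklore] -/
theorem two_le_finrank_of_mem {T : Submodule ℂ V3} {v₁ v₂ : V3} (h₁ : v₁ ∈ T) (h₂ : v₂ ∈ T)
    (hli : LinearIndependent ℂ ![v₁, v₂]) : 2 ≤ finrank ℂ T := by
  have hli' : LinearIndependent ℂ ![(⟨v₁, h₁⟩ : T), ⟨v₂, h₂⟩] := by
    refine LinearIndependent.of_comp T.subtype ?_
    convert hli using 1
    funext i; fin_cases i <;> rfl
  simpa using hli'.fintype_card_le_finrank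

/-- The coordinate vectors are pairwise independent. [folklore] -/
theorem linearIndependent_pt_pair {y z s y' z' s' : ℂ}
    (h : ∀ a b : ℂ, a * y + b * y' = 0 → a * z + b * z' = 0 → a * s + b * s' = 0 → a = 0 ∧ b = 0) :
    LinearIndependent ℂ ![pt y z s, pt y' z' s'] := by
  refine LinearIndependent.pair_iff.mpr fun a b hab => ?_
  simp only [smul_pt, pt_add] at hab
  have := pt_inj (hab.trans pt_zero.symm)
  exact h a b this.1 this.2.1 this.2.2

end Subgroups


/-! ### Corollary 5.2: the non-vanishing of some `F^{(k)}(ω₁/2 + y)` -/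

section Main

variable (L : PeriodPair)

/-- `dim M₀ = 3`. [folklore] -/
theorem model_dim : (model L).dim = 3 := by
  show Fintype.card (Unit ⊕ (Unit ⊕ Unit)) = 3
  simp

/-- `dim ℂx₀ = 1`. [folklore] -/
theorem finrank_span_dir (c : ℂ) (m : ℕ) : finrank ℂ (ℂ ∙ dir c m) = 1 :=
  finrank_span_singleton (dir_ne_zero c m)

/-- `(1, 0, 0) ∈ Lie G'` when `A = 0`; `(0, 0, 1) ∈ Lie G'` when `Ξ = 0`; `(0, 1, 0)` when `C = 0`. [folklore] -/
theorem pt_mem_tangent (K : SubgroupDataC Unit Unit Unit κ0) :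
    (K.A = ⊥ → pt 1 0 0 ∈ K.tangent) ∧ (K.C = ⊥ → pt 0 1 0 ∈ K.tangent) ∧ (K.Ξ = ⊥ → pt 0 0 1 ∈ K.tangent) := by
  refine ⟨fun h => ?_, fun h => ?_, fun h => ?_⟩ <;> rw [mem_tangent_iff'] <;> simp [h]

/-- The arithmetic of the refutations: `a·k ≤ b·k³` with `e ≥ 1` … packaged as
`A · B · k ≤ c · k³ ⟹ A · B ≤ c · k²` (`k ≥ 1`). [folklore] -/
theorem le_of_mul_pow_le {A B N c k f : ℕ} (hk : 1 ≤ k) (hBN : B ≤ N) (hf : 1 ≤ f)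
    (h : A * N * k ^ f ≤ c * k ^ 3) : A * B ≤ c * k ^ 2 := by
  have h1 : A * B * k ^ 1 ≤ A * N * k ^ f :=
    Nat.mul_le_mul (Nat.mul_le_mul_left _ hBN) (Nat.pow_le_pow_right hk hf)
  have h2 : A * B * k ≤ c * k ^ 2 * k := by
    rw [pow_one] at h1
    calc A * B * k ≤ A * N * k ^ f := h1
      _ ≤ c * k ^ 3 := h
      _ = c * k ^ 2 * k := by ring
  exact Nat.le_of_mul_le_mul_right h2 (by omega)

/-- Variant with two powers cancelled: `A · B · k² ≤ c · k³ ⟹ A · B ≤ c · k`. [folklore] -/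
theorem le_of_mul_pow_le' {A B N c k f : ℕ} (hk : 1 ≤ k) (hBN : B ≤ N) (hf : 2 ≤ f)
    (h : A * N * k ^ f ≤ c * k ^ 3) : A * B ≤ c * k := by
  have h1 : A * B * k ^ 2 ≤ A * N * k ^ f :=
    Nat.mul_le_mul (Nat.mul_le_mul_left _ hBN) (Nat.pow_le_pow_right hk hf)
  have h2 : A * B * k ^ 2 ≤ c * k * k ^ 2 := by
    calc A * B * k ^ 2 ≤ A * N * k ^ f := h1
      _ ≤ c * k ^ 3 := h
      _ = c * k * k ^ 2 := by ring
  exact Nat.le_of_mul_le_mul_right h2 (by positivity)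

/-- **Tubbs 1990, Corollary 5.2 (non-vanishing), via Philippon's zero estimate on `𝔾ₐ × 𝔾ₘ × E`.**
Let `c ≠ 0` with `‖e^{cω₂}‖ ≠ 1`, `m ≥ 1`, `mL₁ ≤ D`, `X, D ≥ 1`, and let `p ≠ 0` be a coefficient family.
If the four inequalities `c_Z (4D)³ < (T'+1) m X²`, `c_Z (4D)² < (T'+1) m X`, `c_Z (4D)² < (T'+1) X²`,
`c_Z (4D) < T'+1` hold (`c_Z = c_Z(L)` the constant of the zero estimate on `M₀`), then some derivative
`F_p^{(k)}(ω₁/2 + n₁ω₁ + n₂ω₂)`, `n₁, n₂ < 3X`, `k ≤ 3T'`, is non-zero. (Tubbs: "if we apply the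
product formula (13) to the inequality (14) it follows that one of the following inequalities must
hold: (15)–(18) … By our choices of `T, D` and `S` none of these can hold.")
[cite: Tubbs1990, §5 Cor. 5.2 (pp. 125–126)] [cite: Philippon1986, Thm. 2.1] -/
theorem exists_iteratedDeriv_auxF_ne_zero {c : ℂ} (hc : c ≠ 0) (hB : ‖cexp (c * L.ω₂)‖ ≠ 1)
    {D L₁ m X T' : ℕ} (hm : 1 ≤ m) (hmL : m * L₁ ≤ D) (hX : 1 ≤ X) (hD : 1 ≤ D)
    {p : Coeff D L₁ → ℂ} (hp : p ≠ 0)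
    (h1 : (model L).mainConst * (4 * D) ^ 3 < (T' + 1) * (m * X ^ 2))
    (h2 : (model L).mainConst * (4 * D) ^ 2 < (T' + 1) * (m * X))
    (h3 : (model L).mainConst * (4 * D) ^ 2 < (T' + 1) * X ^ 2)
    (h5 : (model L).mainConst * (4 * D) < T' + 1) :
    ∃ n₁ n₂ k : ℕ, n₁ < 3 * X ∧ n₂ < 3 * X ∧ k < 3 * T' + 1 ∧
      iteratedDeriv k (auxF L c D L₁ p) (L.ω₁ / 2 + latt L n₁ n₂) ≠ 0 := by
  by_contra hcon
  push Not at hcon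
  obtain ⟨α, hP0⟩ := exists_F_auxPolyT_ne_zero L c hm hmL hp
  have hP : (auxPolyT L c D L₁ m α p).IsHomogeneous (4 * D) := auxPolyT_isHomogeneous L c D L₁ m α p
  have hdim : (model L).dim = 3 := model_dim L
  -- the vanishing on `Σ(3)`
  have hvan : ∀ σ ∈ sumset (pts L c m X) (model L).dim,
      VanishesToOrder (ℂ ∙ dir c m) ((model L).F (auxPolyT L c D L₁ m α p)) σ ((model L).dim * T' + 1) := by
    intro σ hσ
    rw [hdim] at hσ ⊢
    obtain ⟨n₁, n₂, K, hn₁, hn₂, rfl⟩ := mem_sumset_pts L c hσ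
    exact vanishesToOrder_auxPolyT L c hm hmL α p _ K fun k hk => hcon n₁ n₂ k (by omega) (by omega) hk
  obtain ⟨H₀, -, hirr, ⟨v₀, hv₀⟩, hineq⟩ := (model L).zero_estimate (ℂ ∙ dir c m) (pts_finite L c m X)
    (zero_mem_pts L c hm hX) hP hP0 hvan
  obtain ⟨K, hKH, hlin, hdimK⟩ :=
    classification_oneFactor_of_hardData L κ0 (hardData L κ0) (by simp) H₀ hirr
  have hKH' : preimageSubgroup L κ0 K = H₀ := SetLike.coe_injective hKH
  subst hKH'
  -- the case `G' = M₀` contradicts `F_{P̃'} ≢ 0`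
  by_cases htop : K.A = ⊥ ∧ K.C = ⊥ ∧ K.Ξ = ⊥
  · have hT := tangent_eq_top K htop.1 htop.2.1 htop.2.2
    obtain ⟨w, hw⟩ := hP0
    apply hw
    have hmem : w - v₀ ∈ preimageSubgroup L κ0 K :=
      AddSubgroup.mem_sup_left (by rw [Submodule.mem_toAddSubgroup, hT]; trivial)
    have := hv₀ (w - v₀) hmem
    rwa [add_sub_cancel] at this
  have hK : K.A ≠ ⊥ ∨ K.C ≠ ⊥ ∨ K.Ξ ≠ ⊥ := by
    by_contra h'
    push Not at h'
    exact htop h'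
  -- otherwise `s = 1` and the inequality reads `(T'+1) · N · (4D)^{coneDim-1} ≤ c_Z (4D)³`
  have hs : finrank ℂ (ℂ ∙ dir c m) -
      finrank ℂ ↥((ℂ ∙ dir c m) ⊓ linSpace ((preimageSubgroup L κ0 K : AddSubgroup V3) : Set V3)) = 1 := by
    rw [hlin, span_dir_inf_tangent hc hm K hK, finrank_bot, finrank_span_dir]
  rw [hs, Nat.choose_one_right, hdim, ncard_image_vadd_eq_ncard_image_mk _ (pts_finite L c m X)] at hineq
  have h4D : 1 ≤ 4 * D := by omega
  have hdimK' : finrank ℂ K.tangent + 1 ≤ (model L).coneDim ((preimageSubgroup L κ0 K : AddSubgroup V3) : Set V3) :=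
    hdimK
  have hexp : finrank ℂ K.tangent ≤ (model L).coneDim ((preimageSubgroup L κ0 K : AddSubgroup V3) : Set V3) - 1 :=
    by omega
  have key : (T' + 1) * ((QuotientAddGroup.mk : V3 → V3 ⧸ preimageSubgroup L κ0 K) '' pts L c m X).ncard *
      (4 * D) ^ finrank ℂ K.tangent ≤ (model L).mainConst * (4 * D) ^ 3 :=
    le_trans (Nat.mul_le_mul_left _ (Nat.pow_le_pow_right h4D hexp)) hineq
  obtain ⟨hptA, hptC, hptΞ⟩ := pt_mem_tangent K
  have hne : ∀ {y z s : ℂ}, pt y z s = 0 → y = 0 ∧ z = 0 ∧ s = 0 := fun h0 => pt_inj (h0.trans pt_zero.symm)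
  have hne₁ : pt (1 : ℂ) 0 0 ≠ 0 := fun h0 => one_ne_zero (hne h0).1
  have hne₃ : pt (0 : ℂ) 0 1 ≠ 0 := fun h0 => one_ne_zero (hne h0).2.2
  -- the four cases
  by_cases hΞ : K.Ξ = ⊥
  · -- `s` is free: `(0,0,1) ∈ Lie G'`
    have hf : 1 ≤ finrank ℂ K.tangent := one_le_finrank_of_mem (hptΞ hΞ) hne₃
    by_cases hA : K.A = ⊥
    · -- `G' = 𝔾ₐ × 𝔾ₘ`: two free coordinates, count `≥ 1`
      have hf2 : 2 ≤ finrank ℂ K.tangent :=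
        two_le_finrank_of_mem (hptA hA) (hptΞ hΞ) (linearIndependent_pt_pair fun a b h₁ _ h₃ =>
          ⟨by simpa using h₁, by simpa using h₃⟩)
      have := le_of_mul_pow_le' h4D (one_le_ncard L c K hm hX) hf2 key
      rw [mul_one] at this
      exact absurd h5 (not_lt.mpr this)
    · -- `G' ⊆ 𝔾ₐ × E` with `A ≠ 0`: count `≥ mX`
      have := le_of_mul_pow_le h4D (mul_le_ncard_of_A L c hB K hA hm X hX) hf key
      exact absurd h2 (not_lt.mpr this)
  · by_cases hA : K.A = ⊥
    · -- `G' ⊇ 𝔾ₘ`, `G' ⊆ 𝔾ₘ × E`: `(1,0,0)` free, count `≥ X²`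
      have hf : 1 ≤ finrank ℂ K.tangent := one_le_finrank_of_mem (hptA hA) hne₁
      have := le_of_mul_pow_le h4D (sq_le_ncard_of_Ξ L c K hΞ m X hm) hf key
      exact absurd h3 (not_lt.mpr this)
    · -- `G' ⊆ E`: count `≥ mX²`
      have hcnt := mul_sq_le_ncard_of_A_Ξ L c K hA hΞ m X
      have : (T' + 1) * (m * X ^ 2) ≤ (model L).mainConst * (4 * D) ^ 3 :=
        calc (T' + 1) * (m * X ^ 2) = (T' + 1) * (m * X ^ 2) * 1 := (mul_one _).symm
          _ ≤ (T' + 1) * ((QuotientAddGroup.mk : V3 → V3 ⧸ preimageSubgroup L κ0 K) '' pts L c m X).ncard *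
                (4 * D) ^ finrank ℂ K.tangent :=
              Nat.mul_le_mul (Nat.mul_le_mul_left _ hcnt) (Nat.one_le_pow _ _ (by omega))
          _ ≤ _ := key
      exact absurd h1 (not_lt.mpr this)

end Main

end Tubbs

end Literature.NumberTheory.Transcendental
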